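import Mathlib
import HarnessLib
import Summits.Ventures.LatticeQCDFlow.Scoring.DoeblinAutocorrelation

/-!
# The Doeblin autocorrelation envelope is sharp: the lazy kernel `ε π + (1 − ε) δ_x` attains
# `ρ_t = (1 − ε)ᵗ` and `τ_int = 1/ε − 1/2` for EVERY observable

HONEST FRAMING: exact (Metropolis-corrected) sampling algorithms for lattice gauge theory;
figures of merit are autocorrelation/cost numbers at stated couplings and volumes; no
continuum-physics claim.

Venture `LatticeQCDFlow` (cell pub-lqcd), topic `Scoring`; FANOUT row 8 (`s0-cpn-nemc`, GEN-10).
NEW WORK of the cell (elementary), not a published result; companion of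
`Scoring/DoeblinAutocorrelation.lean` (`abs_acf_le_of_doeblin`: `|ρ_t| ≤ (1 − ε)ᵗ`,
`tauInt_le_of_doeblin`: `τ_int ≤ 1/ε − 1/2` for every bounded measurable centred observable of a
Markov kernel with `κ(x,·) ≥ ε π`, `π` invariant).  It shows those constants cannot be improved as
functions of `ε` alone, on ANY measurable space: the LAZY kernel `κ(x,·) = ε π + (1 − ε) δ_x`
(redraw from `π` with probability `ε`, else stay — the general-state-space form of the finite
`Exactness.lazyLayer` of `Exactness/LazyLayers.lean`, whose `cov_lazyLayer_lawAt` is the finite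
counterpart of `lazy_autocov` below) is minorised by `π` with constant exactly `ε`, leaves `π`
invariant, and EVERY bounded measurable centred observable has `(kop κ)^[t] f = (1 − ε)ᵗ f`,
`C_f(t) = (1 − ε)ᵗ Var_π f` and `τ_int(f) = 1/ε − 1/2` — equality in both bounds, for all `f` at once.

## Content (hypothesis `hκ : ∀ x, κ x = ε • π + (1 − ε) • Measure.dirac x`, `ε ≤ 1`)

* `lazy_minorised`, `lazy_isMarkovKernel`, `lazy_invariant` — the hypotheses of the envelope hold
  with constant `ε`;
* `lazy_kop` (`kop κ g = ε π(g) + (1 − ε) g`), `lazy_iterate_kop` (`(kop κ)^[t] f = (1 − ε)ᵗ f` for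
  centred `f`), **`lazy_autocov`** (`C_f(t) = (1 − ε)ᵗ ∫ f² dπ`), **`lazy_tauInt`**
  (`τ_int(f) = 1/ε − 1/2` for `Var_π f ≠ 0`, `0 < ε`) — the envelope with EQUALITY;
* `lazyKernel_apply` — such a kernel exists: `Kernel.const Ω (ε • π) + Kernel.withDensity Kernel.id
  (fun _ _ => 1 − ε)` has `κ x = ε π + (1 − ε) δ_x`.
-/

noncomputable section

namespace Summit.Ventures.LatticeQCDFlow.Scoring

open MeasureTheory ProbabilityTheory Filter
open scoped ENNReal

variable {Ω : Type*} [MeasurableSpace Ω]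

section Lazy

variable {κ : Kernel Ω Ω} {π : Measure Ω} [IsProbabilityMeasure π] {ε : ℝ≥0∞}

omit [IsProbabilityMeasure π] in
/-- A lazy kernel is minorised by `π` with constant `ε`. -/
theorem lazy_minorised (hκ : ∀ x, κ x = ε • π + (1 - ε) • Measure.dirac x) (x : Ω) {B : Set Ω}
    (_hB : MeasurableSet B) : ε * π B ≤ κ x B := by
  rw [hκ x, Measure.add_apply, Measure.smul_apply, smul_eq_mul]
  exact le_self_add

/-- A lazy kernel is Markov (`ε ≤ 1`). -/
theorem lazy_isMarkovKernel (hκ : ∀ x, κ x = ε • π + (1 - ε) • Measure.dirac x) (hε1 : ε ≤ 1) :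
    IsMarkovKernel κ := by
  refine ⟨fun x => ⟨?_⟩⟩
  rw [hκ x, Measure.add_apply, Measure.smul_apply, Measure.smul_apply, smul_eq_mul, smul_eq_mul,
    measure_univ, measure_univ, mul_one, mul_one, add_tsub_cancel_of_le hε1]

/-- A lazy kernel leaves `π` invariant. -/
theorem lazy_invariant (hκ : ∀ x, κ x = ε • π + (1 - ε) • Measure.dirac x) (hε1 : ε ≤ 1) :
    Kernel.Invariant κ π := by
  change π.bind κ = π
  ext B hB
  rw [Measure.bind_apply hB (Kernel.aemeasurable κ)]
  have h : ∀ x, κ x B = ε * π B + (1 - ε) * B.indicator 1 x := fun x => by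
    rw [hκ x, Measure.add_apply, Measure.smul_apply, Measure.smul_apply, smul_eq_mul, smul_eq_mul,
      Measure.dirac_apply' x hB]
  have h1top : 1 - ε ≠ ⊤ := ne_top_of_le_ne_top ENNReal.one_ne_top tsub_le_self
  simp_rw [h]
  rw [lintegral_add_left measurable_const, lintegral_const, measure_univ, mul_one,
    lintegral_const_mul' (1 - ε) (B.indicator 1) h1top, lintegral_indicator_one hB, ← add_mul,
    add_tsub_cancel_of_le hε1, one_mul]

/-- `kop` of a lazy kernel: `kop κ g x = ε π(g) + (1 − ε) g x` (bounded measurable `g`). -/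
theorem lazy_kop (hκ : ∀ x, κ x = ε • π + (1 - ε) • Measure.dirac x) (hε1 : ε ≤ 1) {g : Ω → ℝ}
    (hg : Measurable g) {C : ℝ} (hC : ∀ x, |g x| ≤ C) (x : Ω) :
    kop κ g x = ε.toReal * ∫ y, g y ∂π + (1 - ε.toReal) * g x := by
  have hεtop : ε ≠ ⊤ := ne_top_of_le_ne_top ENNReal.one_ne_top hε1
  have h1top : 1 - ε ≠ ⊤ := ne_top_of_le_ne_top ENNReal.one_ne_top tsub_le_self
  unfold kop
  rw [hκ x, integral_add_measure ((integrable_of_bounded π hg hC).smul_measure hεtop)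
    ((integrable_of_bounded (Measure.dirac x) hg hC).smul_measure h1top), integral_smul_measure,
    integral_smul_measure, integral_dirac' _ _ hg.stronglyMeasurable, smul_eq_mul, smul_eq_mul,
    ENNReal.toReal_sub_of_le hε1 ENNReal.one_ne_top, ENNReal.toReal_one]

/-- On a `π`-centred bounded measurable `f`: `(kop κ)^[t] f = (1 − ε)ᵗ · f`. -/
theorem lazy_iterate_kop (hκ : ∀ x, κ x = ε • π + (1 - ε) • Measure.dirac x) (hε1 : ε ≤ 1)
    {f : Ω → ℝ} (hf : Measurable f) {C : ℝ} (hC : ∀ x, |f x| ≤ C) (hf0 : ∫ x, f x ∂π = 0) :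
    ∀ t : ℕ, (kop κ)^[t] f = fun x => (1 - ε.toReal) ^ t * f x := by
  intro t
  induction t with
  | zero => funext x; simp
  | succ t ih =>
    rw [Function.iterate_succ_apply', ih, kop_const_mul]
    funext x
    rw [lazy_kop hκ hε1 hf hC x, hf0, mul_zero, zero_add]
    ring

/-- **The envelope with equality**: `C_f(t) = (1 − ε)ᵗ · ∫ f² dπ` for every `π`-centred bounded
measurable observable of a lazy kernel. -/
theorem lazy_autocov (hκ : ∀ x, κ x = ε • π + (1 - ε) • Measure.dirac x) (hε1 : ε ≤ 1)
    {f : Ω → ℝ} (hf : Measurable f) {C : ℝ} (hC : ∀ x, |f x| ≤ C) (hf0 : ∫ x, f x ∂π = 0)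
    (t : ℕ) : autocov κ π f t = (1 - ε.toReal) ^ t * ∫ x, f x ^ 2 ∂π := by
  unfold autocov
  rw [lazy_iterate_kop hκ hε1 hf hC hf0 t, ← integral_const_mul]
  refine integral_congr_ae (ae_of_all _ fun x => ?_)
  show f x * ((1 - ε.toReal) ^ t * f x) = (1 - ε.toReal) ^ t * f x ^ 2
  ring

/-- **`τ_int = 1/ε − 1/2` exactly**, for every `π`-centred bounded measurable observable with
`∫ f² dπ ≠ 0` of a lazy kernel with `0 < ε ≤ 1`: the bound `tauInt_le_of_doeblin` is attained, by
all observables at once. -/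
theorem lazy_tauInt (hκ : ∀ x, κ x = ε • π + (1 - ε) • Measure.dirac x) (hε0 : 0 < ε)
    (hε1 : ε ≤ 1) {f : Ω → ℝ} (hf : Measurable f) {C : ℝ} (hC : ∀ x, |f x| ≤ C)
    (hf0 : ∫ x, f x ∂π = 0) (hV : ∫ x, f x ^ 2 ∂π ≠ 0) :
    tauInt (fun t => autocov κ π f t / autocov κ π f 0) = 1 / ε.toReal - 1 / 2 := by
  have hεtop : ε ≠ ⊤ := ne_top_of_le_ne_top ENNReal.one_ne_top hε1
  have hεr0 : 0 < ε.toReal := ENNReal.toReal_pos hε0.ne' hεtop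
  have hεr1 : ε.toReal ≤ 1 := by
    have := ENNReal.toReal_mono ENNReal.one_ne_top hε1
    rwa [ENNReal.toReal_one] at this
  have hρ : (fun t => autocov κ π f t / autocov κ π f 0) = fun t => (1 - ε.toReal) ^ t := by
    funext t
    rw [lazy_autocov hκ hε1 hf hC hf0 t, lazy_autocov hκ hε1 hf hC hf0 0, pow_zero, one_mul,
      mul_div_cancel_right₀ _ hV]
  have habs : |1 - ε.toReal| < 1 := by
    rw [abs_lt]; constructor <;> linarith
  have hne : ε.toReal ≠ 0 := hεr0.ne'
  rw [hρ, tauInt_geometric habs, sub_sub_cancel, eq_sub_iff_add_eq,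
    div_add_div _ _ (mul_ne_zero two_ne_zero hne) two_ne_zero,
    div_eq_div_iff (mul_ne_zero (mul_ne_zero two_ne_zero hne) two_ne_zero) hne]
  ring

end Lazy

/-! ### Such a kernel exists -/

/-- The lazy kernel as a Mathlib kernel: `Kernel.const Ω (ε • π) + Kernel.withDensity Kernel.id
(fun _ _ => 1 − ε)` evaluates to `ε π + (1 − ε) δ_x` at every state. -/
theorem lazyKernel_apply (π : Measure Ω) [IsProbabilityMeasure π] (ε : ℝ≥0∞) (x : Ω) :
    ((Kernel.const Ω (ε • π) + Kernel.withDensity (Kernel.id : Kernel Ω Ω) (fun _ _ => 1 - ε)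
        : Kernel Ω Ω) x) = ε • π + (1 - ε) • Measure.dirac x := by
  rw [Kernel.add_apply, Kernel.const_apply]
  congr 1
  ext B hB
  rw [Kernel.withDensity_apply' _ measurable_const, Kernel.id_apply, setLIntegral_const,
    Measure.smul_apply, smul_eq_mul]

end Summit.Ventures.LatticeQCDFlow.Scoring

end
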